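import Mathlib
import HarnessLib

/-!
# LINE (A) `product_plus_one` — the θ-derivative tower of an unswitched incoherent trinomial row (calculus layer, part 1)

Crux item stmt-ValiantsHypothesis-18050, LINE (A) floor structure (memo `pub/val-lit/lmr/NOTE-p7g15-18050-LINEA-incoherent-cell.md` §11–§12).
One row `a − b x^p − c x^q` (`p = e₁+1`, `q = e₁+e₂+2`, `b, c ≥ 0`, unswitched: `a − b x^p − c x^q > 0`), `θ = x·d/dx`.  Closed forms (written out,
no definitions): `H_k(x) = p^k b x^p + q^k c x^q` (`θH_k = H_{k+1}`), `u = 1/(a − b x^p − c x^q)` (`θu = H₁u²`), and the Euler-ratio tower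
`ψ = H₁u`, `θψ = H₂u + H₁²u²`, `θ²ψ = H₃u + 3H₁H₂u² + 2H₁³u³`, `θ³ψ = H₄u + (4H₁H₃ + 3H₂²)u² + 12H₁²H₂u³ + 6H₁⁴u⁴`.

* `hasDerivAt_Hk` — `d/dx H_k = H_{k+1}/x`;  `hasDerivAt_uInv` — `d/dx u = (H₁/x)·u²`;
* `hasDerivAt_psi0`, `hasDerivAt_psi1`, `hasDerivAt_psi2` — `d/dx` of `ψ`, `θψ`, `θ²ψ` equals the next closed form divided by `x`;
Part 3 (`…CloudMonotone`) sums the tower over a cloud, adds the log-convexity inequalities (`…LogConvexAlgebra`) and feeds `oneRiser_no_four_zeros_of_tower`.  Honest framing: calculus of one row;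
NOT `OneChangeFloorK3` / `stub_classRowK3` / `stub_polyLaw` / `MatrixDescartes` / B; `VP ≠ VNP` NOT proved.  No definitions, no named facts; Mathlib only.
-/

set_option linter.dupNamespace false

namespace Summit.ValiantsHypothesis.ValiantsHypothesis.Theorems.LacunarySymmetroidMatrixDescartes

namespace ProductPlusOne

/-- `d/dx (β x^p + γ x^q) = (p β x^p + q γ x^q)/x` for `x ≠ 0` (`p, q ≥ 1`). -/
theorem hasDerivAt_Hk (e₁ e₂ : ℕ) (β γ : ℝ) {x : ℝ} (hx : x ≠ 0) :
    HasDerivAt (fun t : ℝ => β * t ^ (e₁ + 1) + γ * t ^ (e₁ + e₂ + 2))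
      ((((e₁ : ℝ) + 1) * β * x ^ (e₁ + 1) + ((e₁ : ℝ) + e₂ + 2) * γ * x ^ (e₁ + e₂ + 2)) / x) x := by
  have hp1 : HasDerivAt (fun t : ℝ => t ^ (e₁ + 1)) (((e₁ + 1 : ℕ) : ℝ) * x ^ e₁) x := by
    simpa using hasDerivAt_pow (e₁ + 1) x
  have hp2 : HasDerivAt (fun t : ℝ => t ^ (e₁ + e₂ + 2)) (((e₁ + e₂ + 2 : ℕ) : ℝ) * x ^ (e₁ + e₂ + 1)) x := by
    simpa using hasDerivAt_pow (e₁ + e₂ + 2) x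
  refine ((hp1.const_mul β).add (hp2.const_mul γ)).congr_deriv ?_
  have hx1 : x ^ (e₁ + 1) = x ^ e₁ * x := pow_succ x e₁
  have hx2 : x ^ (e₁ + e₂ + 2) = x ^ (e₁ + e₂ + 1) * x := pow_succ x (e₁ + e₂ + 1)
  push_cast
  field_simp
  rw [hx1, hx2]
  ring

/-- `d/dx u = (H₁/x)·u²` for `u = 1/(a − b x^p − c x^q)` where the row does not vanish. -/
theorem hasDerivAt_uInv (e₁ e₂ : ℕ) (a b c : ℝ) {x : ℝ} (hx : x ≠ 0) (hF : a - b * x ^ (e₁ + 1) - c * x ^ (e₁ + e₂ + 2) ≠ 0) :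
    HasDerivAt (fun t : ℝ => (a - b * t ^ (e₁ + 1) - c * t ^ (e₁ + e₂ + 2))⁻¹)
      (((((e₁ : ℝ) + 1) * b * x ^ (e₁ + 1) + ((e₁ : ℝ) + e₂ + 2) * c * x ^ (e₁ + e₂ + 2)) / x)
        * ((a - b * x ^ (e₁ + 1) - c * x ^ (e₁ + e₂ + 2))⁻¹) ^ 2) x := by
  have hH := hasDerivAt_Hk e₁ e₂ b c hx
  have hF' : HasDerivAt (fun t : ℝ => a - b * t ^ (e₁ + 1) - c * t ^ (e₁ + e₂ + 2))
      (-((((e₁ : ℝ) + 1) * b * x ^ (e₁ + 1) + ((e₁ : ℝ) + e₂ + 2) * c * x ^ (e₁ + e₂ + 2)) / x)) x := by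
    have := (hasDerivAt_const x a).sub hH
    refine this.congr_of_eventuallyEq (Filter.Eventually.of_forall fun t => ?_) |>.congr_deriv (by ring)
    simp only [Pi.sub_apply]; ring
  refine (hF'.inv hF).congr_deriv ?_
  field_simp

/-- `d/dx ψ = θψ/x`:  `ψ = H₁u`, `θψ = H₂u + H₁²u²`. -/
theorem hasDerivAt_psi0 (e₁ e₂ : ℕ) (a b c : ℝ) {x : ℝ} (hx : x ≠ 0) (hF : a - b * x ^ (e₁ + 1) - c * x ^ (e₁ + e₂ + 2) ≠ 0) :
    HasDerivAt (fun t : ℝ => (((e₁ : ℝ) + 1) * b * t ^ (e₁ + 1) + ((e₁ : ℝ) + e₂ + 2) * c * t ^ (e₁ + e₂ + 2))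
        * (a - b * t ^ (e₁ + 1) - c * t ^ (e₁ + e₂ + 2))⁻¹)
      (((((e₁ : ℝ) + 1) ^ 2 * b * x ^ (e₁ + 1) + ((e₁ : ℝ) + e₂ + 2) ^ 2 * c * x ^ (e₁ + e₂ + 2))
          * (a - b * x ^ (e₁ + 1) - c * x ^ (e₁ + e₂ + 2))⁻¹
        + (((e₁ : ℝ) + 1) * b * x ^ (e₁ + 1) + ((e₁ : ℝ) + e₂ + 2) * c * x ^ (e₁ + e₂ + 2)) ^ 2
          * ((a - b * x ^ (e₁ + 1) - c * x ^ (e₁ + e₂ + 2))⁻¹) ^ 2) / x) x := by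
  have hH1 := hasDerivAt_Hk e₁ e₂ (((e₁ : ℝ) + 1) * b) (((e₁ : ℝ) + e₂ + 2) * c) hx
  have hu := hasDerivAt_uInv e₁ e₂ a b c hx hF
  have h := hH1.mul hu
  refine (h.congr_of_eventuallyEq (Filter.Eventually.of_forall fun t => ?_)).congr_deriv ?_
  · simp only [Pi.mul_apply]
  · field_simp

/-- `d/dx θψ = θ²ψ/x`:  `θψ = H₂u + H₁²u²`, `θ²ψ = H₃u + 3H₁H₂u² + 2H₁³u³`. -/
theorem hasDerivAt_psi1 (e₁ e₂ : ℕ) (a b c : ℝ) {x : ℝ} (hx : x ≠ 0) (hF : a - b * x ^ (e₁ + 1) - c * x ^ (e₁ + e₂ + 2) ≠ 0) :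
    HasDerivAt (fun t : ℝ =>
        (((e₁ : ℝ) + 1) ^ 2 * b * t ^ (e₁ + 1) + ((e₁ : ℝ) + e₂ + 2) ^ 2 * c * t ^ (e₁ + e₂ + 2))
            * (a - b * t ^ (e₁ + 1) - c * t ^ (e₁ + e₂ + 2))⁻¹
          + (((e₁ : ℝ) + 1) * b * t ^ (e₁ + 1) + ((e₁ : ℝ) + e₂ + 2) * c * t ^ (e₁ + e₂ + 2)) ^ 2
            * ((a - b * t ^ (e₁ + 1) - c * t ^ (e₁ + e₂ + 2))⁻¹) ^ 2)
      (((((e₁ : ℝ) + 1) ^ 3 * b * x ^ (e₁ + 1) + ((e₁ : ℝ) + e₂ + 2) ^ 3 * c * x ^ (e₁ + e₂ + 2))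
            * (a - b * x ^ (e₁ + 1) - c * x ^ (e₁ + e₂ + 2))⁻¹
          + 3 * (((e₁ : ℝ) + 1) * b * x ^ (e₁ + 1) + ((e₁ : ℝ) + e₂ + 2) * c * x ^ (e₁ + e₂ + 2))
              * (((e₁ : ℝ) + 1) ^ 2 * b * x ^ (e₁ + 1) + ((e₁ : ℝ) + e₂ + 2) ^ 2 * c * x ^ (e₁ + e₂ + 2))
              * ((a - b * x ^ (e₁ + 1) - c * x ^ (e₁ + e₂ + 2))⁻¹) ^ 2
          + 2 * (((e₁ : ℝ) + 1) * b * x ^ (e₁ + 1) + ((e₁ : ℝ) + e₂ + 2) * c * x ^ (e₁ + e₂ + 2)) ^ 3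
              * ((a - b * x ^ (e₁ + 1) - c * x ^ (e₁ + e₂ + 2))⁻¹) ^ 3) / x) x := by
  have hH1 := hasDerivAt_Hk e₁ e₂ (((e₁ : ℝ) + 1) * b) (((e₁ : ℝ) + e₂ + 2) * c) hx
  have hH2 := hasDerivAt_Hk e₁ e₂ (((e₁ : ℝ) + 1) ^ 2 * b) (((e₁ : ℝ) + e₂ + 2) ^ 2 * c) hx
  have hu := hasDerivAt_uInv e₁ e₂ a b c hx hF
  have h := (hH2.mul hu).add ((hH1.pow 2).mul (hu.pow 2))
  refine (h.congr_of_eventuallyEq (Filter.Eventually.of_forall fun t => ?_)).congr_deriv ?_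
  · simp only [Pi.mul_apply, Pi.add_apply, Pi.pow_apply]
  · simp only [Pi.pow_apply]
    push_cast
    field_simp
    ring

/-- `d/dx θ²ψ = θ³ψ/x`:  `θ³ψ = H₄u + (4H₁H₃ + 3H₂²)u² + 12H₁²H₂u³ + 6H₁⁴u⁴`. -/
theorem hasDerivAt_psi2 (e₁ e₂ : ℕ) (a b c : ℝ) {x : ℝ} (hx : x ≠ 0) (hF : a - b * x ^ (e₁ + 1) - c * x ^ (e₁ + e₂ + 2) ≠ 0) :
    HasDerivAt (fun t : ℝ =>
        (((e₁ : ℝ) + 1) ^ 3 * b * t ^ (e₁ + 1) + ((e₁ : ℝ) + e₂ + 2) ^ 3 * c * t ^ (e₁ + e₂ + 2))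
            * (a - b * t ^ (e₁ + 1) - c * t ^ (e₁ + e₂ + 2))⁻¹
          + 3 * (((e₁ : ℝ) + 1) * b * t ^ (e₁ + 1) + ((e₁ : ℝ) + e₂ + 2) * c * t ^ (e₁ + e₂ + 2))
              * (((e₁ : ℝ) + 1) ^ 2 * b * t ^ (e₁ + 1) + ((e₁ : ℝ) + e₂ + 2) ^ 2 * c * t ^ (e₁ + e₂ + 2))
              * ((a - b * t ^ (e₁ + 1) - c * t ^ (e₁ + e₂ + 2))⁻¹) ^ 2
          + 2 * (((e₁ : ℝ) + 1) * b * t ^ (e₁ + 1) + ((e₁ : ℝ) + e₂ + 2) * c * t ^ (e₁ + e₂ + 2)) ^ 3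
              * ((a - b * t ^ (e₁ + 1) - c * t ^ (e₁ + e₂ + 2))⁻¹) ^ 3)
      (((((e₁ : ℝ) + 1) ^ 4 * b * x ^ (e₁ + 1) + ((e₁ : ℝ) + e₂ + 2) ^ 4 * c * x ^ (e₁ + e₂ + 2))
            * (a - b * x ^ (e₁ + 1) - c * x ^ (e₁ + e₂ + 2))⁻¹
          + (4 * (((e₁ : ℝ) + 1) * b * x ^ (e₁ + 1) + ((e₁ : ℝ) + e₂ + 2) * c * x ^ (e₁ + e₂ + 2))
                * (((e₁ : ℝ) + 1) ^ 3 * b * x ^ (e₁ + 1) + ((e₁ : ℝ) + e₂ + 2) ^ 3 * c * x ^ (e₁ + e₂ + 2))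
              + 3 * (((e₁ : ℝ) + 1) ^ 2 * b * x ^ (e₁ + 1) + ((e₁ : ℝ) + e₂ + 2) ^ 2 * c * x ^ (e₁ + e₂ + 2)) ^ 2)
              * ((a - b * x ^ (e₁ + 1) - c * x ^ (e₁ + e₂ + 2))⁻¹) ^ 2
          + 12 * (((e₁ : ℝ) + 1) * b * x ^ (e₁ + 1) + ((e₁ : ℝ) + e₂ + 2) * c * x ^ (e₁ + e₂ + 2)) ^ 2
              * (((e₁ : ℝ) + 1) ^ 2 * b * x ^ (e₁ + 1) + ((e₁ : ℝ) + e₂ + 2) ^ 2 * c * x ^ (e₁ + e₂ + 2))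
              * ((a - b * x ^ (e₁ + 1) - c * x ^ (e₁ + e₂ + 2))⁻¹) ^ 3
          + 6 * (((e₁ : ℝ) + 1) * b * x ^ (e₁ + 1) + ((e₁ : ℝ) + e₂ + 2) * c * x ^ (e₁ + e₂ + 2)) ^ 4
              * ((a - b * x ^ (e₁ + 1) - c * x ^ (e₁ + e₂ + 2))⁻¹) ^ 4) / x) x := by
  have hH1 := hasDerivAt_Hk e₁ e₂ (((e₁ : ℝ) + 1) * b) (((e₁ : ℝ) + e₂ + 2) * c) hx
  have hH2 := hasDerivAt_Hk e₁ e₂ (((e₁ : ℝ) + 1) ^ 2 * b) (((e₁ : ℝ) + e₂ + 2) ^ 2 * c) hx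
  have hH3 := hasDerivAt_Hk e₁ e₂ (((e₁ : ℝ) + 1) ^ 3 * b) (((e₁ : ℝ) + e₂ + 2) ^ 3 * c) hx
  have hu := hasDerivAt_uInv e₁ e₂ a b c hx hF
  have h := ((hH3.mul hu).add (((hH1.mul hH2).mul (hu.pow 2)).const_mul 3)).add (((hH1.pow 3).mul (hu.pow 3)).const_mul 2)
  refine (h.congr_of_eventuallyEq (Filter.Eventually.of_forall fun t => ?_)).congr_deriv ?_
  · simp only [Pi.mul_apply, Pi.add_apply, Pi.pow_apply]; ring
  · simp only [Pi.mul_apply, Pi.pow_apply]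
    push_cast
    field_simp
    ring

end ProductPlusOne

end Summit.ValiantsHypothesis.ValiantsHypothesis.Theorems.LacunarySymmetroidMatrixDescartes
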